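import Summits.CriticalPhenomena.PercolationContinuityZ3.Theorems.FK.InfiniteVolumeDLRLocalLimitEnergy
import Summits.CriticalPhenomena.PercolationContinuityZ3.Theorems.FK.InfiniteVolumeDLRKernelOneEdge
import Summits.CriticalPhenomena.PercolationContinuityZ3.Theorems.FK.InfiniteVolumeDLROneEdgeIff
import HarnessLib

/-!
# FK-continuity transplant, FO-10 (infinite-volume structure): Grimmett 2006, Theorem (4.31) —
# local limits of random-cluster measures with the 0/1-infinite-cluster property are DLR random-cluster measures

Registered R90 (cell INBOX l.6412, 2026-08-24); registry row FO-10b-g409; label DLL-C (coordinator fk-4 g195).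
Cell `fk-continuity` (bschramm), FO-10b lineage; support file for the FK-continuity transplant
(`--supports stmt-CriticalPhenomena-4575`); builds on p205010 (kernel theorem, internal audit signed; external
expert review pending). CONDITIONAL cell (FH AND TP_FK open at the same `p` for `q > 1`; K1); the transplant is a
typed reduction, not a proof of FK continuity — this file is UNCONDITIONAL infinite-volume structure for general `d`,
`0 ≤ p ≤ 1` and EVERY `q > 0` (no FKG input); no defs, no named facts, no sorries, standard axioms; NOT a binder
discharge, NOT `_r4`; `_r3` « 2 / 0 ☑ » unchanged, n_open = 2.

## What this file proves (Grimmett 2006, Thm. (4.31), pp. 81–86, in the tree's local-limit vocabulary)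

Grimmett's Theorem (4.31): *if `φ ∈ cl co W_{p,q}` has the 0/1-infinite-cluster property, then `φ ∈ R_{p,q}`.*
Here, without a definition of `W_{p,q}`: let `μ_n` be finite measures on `Ω` carried by lattice configurations,
converging to the probability measure `P` on every local event, such that for every lattice edge `e` EVENTUALLY
`μ_n` has the one-edge conditional probabilities (4.38) at `e` — this covers the finite-volume measures
`φ^{ξ_n}_{Λ_n,p,q}` with lattice boundary conditions and `Λ_n ↑ ℤ^d` (`InfiniteVolumeDLRKernelOneEdge.lean`) and,
the hypothesis being linear in `μ_n`, their finite convex combinations. If `P`-a.s. there is at most one infinite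
cluster, then `P ∈ R_{p,q}`:

* `measureReal_setOf_mem_inter_preimage_eq_of_localLimit_of_isLocalEvent` — the limit identity on LOCAL `H₀`
  (eqs. (4.45)–(4.53): replace `K_e` by `{x ↔ y inside Λ_m}` at cost `≤ μ_n(D_m)`, let `n → ∞`, then `m → ∞`);
* **`measureReal_setOf_mem_inter_preimage_eq_of_localLimit`** — (4.38) at `e` for the limit `P`, every measurable
  `H₀` (from local `H₀` by `…_eq_of_forall_isLocalEvent` of `InfiniteVolumeDLRLocalLimitEnergy.lean`; the degenerate
  case `p = p/(p+q(1-p))`, i.e. `p ∈ {0,1}` or `q = 1`, needs no uniqueness);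
* **`isDLRRandomCluster_of_localLimit`** — THEOREM (4.31): `P ∈ R_{p,q}` (over DLR1e-C `isDLRRandomCluster_of_oneEdge`);
* **`isDLRRandomCluster_of_tendsto_rcCondLaw`** — THEOREM (4.31) FOR `W_{p,q}` PROPER: local limits of the finite-volume
  measures `φ^{ξ_n}_{Λ_n,p,q} = rcCondLaw p q (Λ n) (ξ n)` (`ξ_n ⊆ 𝔼^d`, every lattice edge eventually inside `Λ_n`) with
  a.s. `≤ 1` infinite cluster are in `R_{p,q}` (the kernel's one-edge identities are `InfiniteVolumeDLRKernelOneEdge.lean`);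
  `isDLRRandomCluster_of_tendsto_rcCondLaw_of_forall_percolatesAt_eq_zero` — the same for NON-PERCOLATING limits
  (`P(x ↔ ∞) = 0` for all `x`; no FKG input — the existence route for `q < 1`, Grimmett p. 81).

FO-06b's `IsBoxLimit.isDLRRandomCluster` (the free / wired limits, `q ≥ 1`) is the special case where uniqueness
comes from Burton–Keane; this file makes the 0/1-infinite-cluster property the ONLY input, for every `q > 0`.

## References

* G. Grimmett, *The Random-Cluster Model*, Springer 2006: Def. (4.26)–(4.30), Thm. (4.31), Thm. (4.33),
  Prop. (4.37) eq. (4.38), Lemma (4.39), proof of Thm. (4.31) eqs. (4.45)–(4.53), pp. 79–86. [Grimmett2006]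
-/

noncomputable section

open MeasureTheory Set Filter
open scoped Topology ENNReal symmDiff

namespace Summit.CriticalPhenomena.PercolationContinuityZ3.Theorems.FK

open Literature.Probability.Percolation Literature.Probability.LatticeModels

variable {d : ℕ}

/-! ### The one-edge identity (4.38) in the limit -/

section Main

variable {p q : ℝ} {P : Measure (BondConfig (Site d))} {μ : ℕ → Measure (BondConfig (Site d))} {x y : Site d}

/-- **The one-edge conditional probabilities pass to local limits, on local events** (the heart of Grimmett's
proof of Thm. (4.31), pp. 84–86): if the lattice-carried approximants `μ_n` converge to `P` on local events and
eventually have the one-edge conditional probabilities (4.38) at `e = ⟨x,y⟩`, and `P(D_m) → 0` for the bad events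
`D_m` (which holds as soon as `P`-a.s. `ω ∖ e` has at most one infinite cluster,
`tendsto_measureReal_exit_inter_not_openConnVia`), then `P` has the one-edge conditional probabilities at `e`
against every LOCAL `H₀`. [cite: Grimmett2006, proof of Thm. (4.31), eqs. (4.45)–(4.53), pp. 84–86] -/
theorem measureReal_setOf_mem_inter_preimage_eq_of_localLimit_of_isLocalEvent [IsFiniteMeasure P]
    [∀ n, IsFiniteMeasure (μ n)] (hp : p ∈ Set.Icc (0 : ℝ) 1) (hq : 0 < q)
    (hlat : ∀ n, ∀ᵐ ω ∂(μ n), ω ⊆ (zdGraph d).edgeSet)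
    (hconv : ∀ A : Set (BondConfig (Site d)), IsLocalEvent A → Tendsto (fun n => μ n A) atTop (𝓝 (P A)))
    (hE : ∀ᶠ n in atTop, ∀ ⦃H₀ : Set (BondConfig (Site d))⦄, MeasurableSet H₀ →
      (μ n).real ({ω | s(x, y) ∈ ω} ∩ (fun η => η \ {s(x, y)}) ⁻¹' H₀) =
        p * (μ n).real ((fun η => η \ {s(x, y)}) ⁻¹' (H₀ ∩ openConn x y)) +
          p / (p + q * (1 - p)) * (μ n).real ((fun η => η \ {s(x, y)}) ⁻¹' (H₀ ∩ (openConn x y)ᶜ)))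
    (hD : Tendsto (fun m : ℕ => P.real
      ((fun η : BondConfig (Site d) => η \ {s(x, y)}) ⁻¹' {ω | ∃ c ∈ box d (m + 1), c ∉ box d m ∧
          ω ∈ openConnVia (withinGraph ⊤ (↑(box d (m + 1)) : Set (Site d))) x c} ∩
        (fun η : BondConfig (Site d) => η \ {s(x, y)}) ⁻¹' {ω | ∃ c ∈ box d (m + 1), c ∉ box d m ∧
          ω ∈ openConnVia (withinGraph ⊤ (↑(box d (m + 1)) : Set (Site d))) y c} ∩
        ((fun η : BondConfig (Site d) => η \ {s(x, y)}) ⁻¹'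
          openConnVia (withinGraph ⊤ (↑(box d m) : Set (Site d))) x y)ᶜ)) atTop (𝓝 0))
    {H₀ : Set (BondConfig (Site d))} (hH₀ : IsLocalEvent H₀) :
    P.real ({ω | s(x, y) ∈ ω} ∩ (fun η => η \ {s(x, y)}) ⁻¹' H₀) =
      p * P.real ((fun η => η \ {s(x, y)}) ⁻¹' (H₀ ∩ openConn x y)) +
        p / (p + q * (1 - p)) * P.real ((fun η => η \ {s(x, y)}) ⁻¹' (H₀ ∩ (openConn x y)ᶜ)) := by
  classical
  set f : BondConfig (Site d) → BondConfig (Site d) := fun η => η \ {s(x, y)} with hf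
  set K : Set (BondConfig (Site d)) := openConn x y with hK
  set Km : ℕ → Set (BondConfig (Site d)) := fun m =>
    openConnVia (withinGraph ⊤ (↑(box d m) : Set (Site d))) x y with hKm_def
  set π : ℝ := p / (p + q * (1 - p)) with hπ
  set J : Set (BondConfig (Site d)) := {ω | s(x, y) ∈ ω} with hJ
  set D : ℕ → Set (BondConfig (Site d)) := fun m =>
    f ⁻¹' {ω | ∃ c ∈ box d (m + 1), c ∉ box d m ∧
        ω ∈ openConnVia (withinGraph ⊤ (↑(box d (m + 1)) : Set (Site d))) x c} ∩
      f ⁻¹' {ω | ∃ c ∈ box d (m + 1), c ∉ box d m ∧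
        ω ∈ openConnVia (withinGraph ⊤ (↑(box d (m + 1)) : Set (Site d))) y c} ∩
      (f ⁻¹' (Km m))ᶜ with hD_def
  have hfm : Measurable f := measurable_closeEdges _
  have hKmeas : MeasurableSet K := measurableSet_openConn_holds x y
  have hH₀m : MeasurableSet H₀ := measurableSet_of_isLocalEvent_holds hH₀
  have hKm_loc : ∀ m, IsLocalEvent (Km m) := fun m => isLocalEvent_openConnVia_withinGraph_box m x y
  have hKm_meas : ∀ m, MeasurableSet (Km m) := fun m => measurableSet_of_isLocalEvent_holds (hKm_loc m)
  have hKm_sub : ∀ m, Km m ⊆ K := fun m ω hω => openClusterIn_subset_openCluster _ ω x hω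
  have hden : 0 < p + q * (1 - p) := add_mul_one_sub_pos hp hq
  have hπ0 : 0 ≤ π := div_nonneg hp.1 hden.le
  have hπ1 : π ≤ 1 := by
    rw [hπ, div_le_one hden]
    nlinarith [hq, hp.2]
  -- locality of everything in sight
  have hJloc : IsLocalEvent J := isLocalEvent_setOf_mem _
  have hDloc : ∀ m, IsLocalEvent (D m) := fun m =>
    ((isLocalEvent_preimage_sdiff (isLocalEvent_exit m x) {s(x, y)}).inter
      (isLocalEvent_preimage_sdiff (isLocalEvent_exit m y) {s(x, y)})).inter
      (isLocalEvent_preimage_sdiff (hKm_loc m) {s(x, y)}).compl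
  have hloc1 : IsLocalEvent (J ∩ f ⁻¹' H₀) := isLocalEvent_inter_preimage _ hJloc hH₀
  have hloc2 : ∀ m, IsLocalEvent (f ⁻¹' (H₀ ∩ Km m)) := fun m =>
    isLocalEvent_preimage_sdiff (hH₀.inter (hKm_loc m)) _
  have hloc3 : ∀ m, IsLocalEvent (f ⁻¹' (H₀ ∩ (Km m)ᶜ)) := fun m =>
    isLocalEvent_preimage_sdiff (hH₀.inter (hKm_loc m).compl) _
  -- `x, y ∈ Λ_m` for `m ≥ m₀`
  obtain ⟨m₀, hm₀⟩ := DCT16.exists_subset_box ({x, y} : Finset (Site d))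
  have hxm : ∀ {m}, m₀ ≤ m → x ∈ box d m := fun hm =>
    box_mono d hm (hm₀ (Finset.mem_insert_self _ _))
  have hym : ∀ {m}, m₀ ≤ m → y ∈ box d m := fun hm =>
    box_mono d hm (hm₀ (Finset.mem_insert_of_mem (Finset.mem_singleton_self _)))
  -- the two splittings, for any finite measure
  have split1 : ∀ (ν : Measure (BondConfig (Site d))) [IsFiniteMeasure ν] (m : ℕ),
      ν.real (f ⁻¹' (H₀ ∩ K)) = ν.real (f ⁻¹' (H₀ ∩ Km m)) + ν.real (f ⁻¹' (H₀ ∩ (K \ Km m))) := by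
    intro ν _ m
    rw [← measureReal_union (Set.disjoint_left.2 fun ω h1 h2 => h2.2.2 h1.2)
      ((hH₀m.inter (hKmeas.diff (hKm_meas m))).preimage hfm)]
    congr 1
    ext ω
    simp only [Set.mem_preimage, Set.mem_union, Set.mem_inter_iff, Set.mem_sdiff]
    constructor
    · rintro ⟨hH, hKω⟩
      by_cases h : f ω ∈ Km m
      · exact Or.inl ⟨hH, h⟩
      · exact Or.inr ⟨hH, hKω, h⟩
    · rintro (⟨hH, h⟩ | ⟨hH, hKω, -⟩)
      · exact ⟨hH, hKm_sub m h⟩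
      · exact ⟨hH, hKω⟩
  have split2 : ∀ (ν : Measure (BondConfig (Site d))) [IsFiniteMeasure ν] (m : ℕ),
      ν.real (f ⁻¹' (H₀ ∩ (Km m)ᶜ)) = ν.real (f ⁻¹' (H₀ ∩ Kᶜ)) + ν.real (f ⁻¹' (H₀ ∩ (K \ Km m))) := by
    intro ν _ m
    rw [← measureReal_union (Set.disjoint_left.2 fun ω h1 h2 => h1.2 h2.2.1)
      ((hH₀m.inter (hKmeas.diff (hKm_meas m))).preimage hfm)]
    congr 1
    ext ω
    simp only [Set.mem_preimage, Set.mem_union, Set.mem_inter_iff, Set.mem_sdiff, Set.mem_compl_iff]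
    constructor
    · rintro ⟨hH, hKω⟩
      by_cases h : f ω ∈ K
      · exact Or.inr ⟨hH, h, hKω⟩
      · exact Or.inl ⟨hH, h⟩
    · rintro (⟨hH, h⟩ | ⟨hH, -, hKω⟩)
      · exact ⟨hH, fun h' => h (hKm_sub m h')⟩
      · exact ⟨hH, hKω⟩
  -- Step 1: the approximants, `m ≥ m₀`
  have step1 : ∀ m, m₀ ≤ m → ∀ᶠ n in atTop,
      |(μ n).real (J ∩ f ⁻¹' H₀) - p * (μ n).real (f ⁻¹' (H₀ ∩ Km m)) - π * (μ n).real (f ⁻¹' (H₀ ∩ (Km m)ᶜ))| ≤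
        (μ n).real (D m) := by
    intro m hm
    filter_upwards [hE] with n hn
    have e3 : (μ n).real (f ⁻¹' (H₀ ∩ (K \ Km m))) ≤ (μ n).real (D m) := by
      rw [measureReal_def, measureReal_def]
      refine ENNReal.toReal_mono (measure_ne_top _ _) (measure_mono_ae ?_)
      filter_upwards [hlat n] with ω hω hωm
      have hζ : f ω ⊆ (zdGraph d).edgeSet := Set.sdiff_subset.trans hω
      exact mem_exit_inter_of_mem_openConn_diff hζ (hxm hm) (hym hm) hωm.2.1 hωm.2.2
    rw [hn hH₀m, split1 (μ n) m, split2 (μ n) m]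
    have hr : 0 ≤ (μ n).real (f ⁻¹' (H₀ ∩ (K \ Km m))) := measureReal_nonneg
    have halg : p * ((μ n).real (f ⁻¹' (H₀ ∩ Km m)) + (μ n).real (f ⁻¹' (H₀ ∩ (K \ Km m)))) +
          π * (μ n).real (f ⁻¹' (H₀ ∩ Kᶜ)) - p * (μ n).real (f ⁻¹' (H₀ ∩ Km m)) -
          π * ((μ n).real (f ⁻¹' (H₀ ∩ Kᶜ)) + (μ n).real (f ⁻¹' (H₀ ∩ (K \ Km m)))) =
        (p - π) * (μ n).real (f ⁻¹' (H₀ ∩ (K \ Km m))) := by ring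
    rw [halg, abs_mul, abs_of_nonneg hr]
    have hpπ : |p - π| ≤ 1 := abs_sub_le_iff.2 ⟨by linarith [hp.2], by linarith [hp.1]⟩
    calc |p - π| * (μ n).real (f ⁻¹' (H₀ ∩ (K \ Km m))) ≤ 1 * (μ n).real (f ⁻¹' (H₀ ∩ (K \ Km m))) :=
          mul_le_mul_of_nonneg_right hpπ hr
      _ ≤ (μ n).real (D m) := by rw [one_mul]; exact e3
  -- Step 2: `n → ∞`
  have step2 : ∀ m, m₀ ≤ m →
      |P.real (J ∩ f ⁻¹' H₀) - p * P.real (f ⁻¹' (H₀ ∩ Km m)) - π * P.real (f ⁻¹' (H₀ ∩ (Km m)ᶜ))| ≤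
        P.real (D m) := by
    intro m hm
    have hT : Tendsto (fun n => (μ n).real (J ∩ f ⁻¹' H₀) - p * (μ n).real (f ⁻¹' (H₀ ∩ Km m)) -
        π * (μ n).real (f ⁻¹' (H₀ ∩ (Km m)ᶜ))) atTop
        (𝓝 (P.real (J ∩ f ⁻¹' H₀) - p * P.real (f ⁻¹' (H₀ ∩ Km m)) - π * P.real (f ⁻¹' (H₀ ∩ (Km m)ᶜ)))) :=
      ((tendsto_measureReal_of_tendsto_measure_isLocalEvent hconv hloc1).sub
        ((tendsto_measureReal_of_tendsto_measure_isLocalEvent hconv (hloc2 m)).const_mul p)).sub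
        ((tendsto_measureReal_of_tendsto_measure_isLocalEvent hconv (hloc3 m)).const_mul π)
    exact le_of_tendsto_of_tendsto hT.abs (tendsto_measureReal_of_tendsto_measure_isLocalEvent hconv (hDloc m)) (step1 m hm)
  -- Step 3: `m → ∞`
  have tB : Tendsto (fun m => P.real (f ⁻¹' (H₀ ∩ Km m))) atTop (𝓝 (P.real (f ⁻¹' (H₀ ∩ K)))) := by
    have hmono : Monotone fun m => f ⁻¹' (H₀ ∩ Km m) := fun m m' hmm' ω hω =>
      ⟨hω.1, monotone_openConnVia_withinGraph_box x y hmm' hω.2⟩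
    have hU : (⋃ m, f ⁻¹' (H₀ ∩ Km m)) = f ⁻¹' (H₀ ∩ K) := by
      rw [hK, openConn_eq_iUnion_openConnVia_box]
      ext ω
      simp only [Set.mem_iUnion, Set.mem_preimage, Set.mem_inter_iff]
      constructor
      · rintro ⟨m, hH, hm⟩
        exact ⟨hH, m, hm⟩
      · rintro ⟨hH, m, hm⟩
        exact ⟨m, hH, hm⟩
    rw [← hU]
    exact tendsto_measureReal_iUnion_of_monotone P hmono
  have tC : Tendsto (fun m => P.real (f ⁻¹' (H₀ ∩ (Km m)ᶜ))) atTop (𝓝 (P.real (f ⁻¹' (H₀ ∩ Kᶜ)))) := by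
    have hanti : Antitone fun m => f ⁻¹' (H₀ ∩ (Km m)ᶜ) := fun m m' hmm' ω hω =>
      ⟨hω.1, fun h => hω.2 (monotone_openConnVia_withinGraph_box x y hmm' h)⟩
    have hI : (⋂ m, f ⁻¹' (H₀ ∩ (Km m)ᶜ)) = f ⁻¹' (H₀ ∩ Kᶜ) := by
      rw [hK, openConn_eq_iUnion_openConnVia_box]
      ext ω
      simp only [Set.mem_iInter, Set.mem_preimage, Set.mem_inter_iff, Set.mem_compl_iff, Set.mem_iUnion,
        not_exists]
      constructor
      · intro h
        exact ⟨(h m₀).1, fun m => (h m).2⟩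
      · rintro ⟨hH, h⟩ m
        exact ⟨hH, h m⟩
    rw [← hI]
    exact tendsto_measureReal_iInter_of_antitone P hanti fun m => (hH₀m.inter (hKm_meas m).compl).preimage hfm
  have tG : Tendsto (fun m => P.real (J ∩ f ⁻¹' H₀) - p * P.real (f ⁻¹' (H₀ ∩ Km m)) -
      π * P.real (f ⁻¹' (H₀ ∩ (Km m)ᶜ))) atTop
      (𝓝 (P.real (J ∩ f ⁻¹' H₀) - p * P.real (f ⁻¹' (H₀ ∩ K)) - π * P.real (f ⁻¹' (H₀ ∩ Kᶜ)))) :=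
    (tendsto_const_nhds.sub (tB.const_mul p)).sub (tC.const_mul π)
  have hle : |P.real (J ∩ f ⁻¹' H₀) - p * P.real (f ⁻¹' (H₀ ∩ K)) - π * P.real (f ⁻¹' (H₀ ∩ Kᶜ))| ≤ 0 :=
    le_of_tendsto_of_tendsto tG.abs hD (eventually_atTop.2 ⟨m₀, step2⟩)
  have h0 := abs_nonpos_iff.1 hle
  linarith

end Main

/-! ### Assembly: Grimmett's Theorem (4.31), abstract local-limit form -/

section Assembly

variable {p q : ℝ} {P : Measure (BondConfig (Site d))} {μ : ℕ → Measure (BondConfig (Site d))} {x y : Site d}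

/-- **The one-edge conditional probabilities (4.38) pass to local limits with the 0/1-infinite-cluster property**
(Grimmett 2006, Thm. (4.31), one edge): let `μ_n` be finite measures carried by lattice configurations which
converge to the finite measure `P` on every local event and which EVENTUALLY have the one-edge conditional
probabilities (4.38) at `e = ⟨x,y⟩` (`0 ≤ p ≤ 1`, `q > 0`); if `P`-a.s. there is at most one infinite cluster, then
`P` has the one-edge conditional probabilities (4.38) at `e`, against EVERY measurable `H₀`:
`P({e open} ∩ {ω ∖ e ∈ H₀}) = p P({ω ∖ e ∈ H₀ ∩ K_e}) + p/(p+q(1-p)) P({ω ∖ e ∈ H₀ ∖ K_e})`.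
(When `p = p/(p+q(1-p))`, i.e. `p ∈ {0,1}` or `q = 1`, the uniqueness hypothesis is not used.)
[cite: Grimmett2006, Thm. (4.31) and its proof, pp. 81–86; Prop. (4.37) eq. (4.38)] -/
theorem measureReal_setOf_mem_inter_preimage_eq_of_localLimit [IsFiniteMeasure P] [∀ n, IsFiniteMeasure (μ n)]
    (hp : p ∈ Set.Icc (0 : ℝ) 1) (hq : 0 < q)
    (hlat : ∀ n, ∀ᵐ ω ∂(μ n), ω ⊆ (zdGraph d).edgeSet)
    (hconv : ∀ A : Set (BondConfig (Site d)), IsLocalEvent A → Tendsto (fun n => μ n A) atTop (𝓝 (P A)))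
    (hE : ∀ᶠ n in atTop, ∀ ⦃H₀ : Set (BondConfig (Site d))⦄, MeasurableSet H₀ →
      (μ n).real ({ω | s(x, y) ∈ ω} ∩ (fun η => η \ {s(x, y)}) ⁻¹' H₀) =
        p * (μ n).real ((fun η => η \ {s(x, y)}) ⁻¹' (H₀ ∩ openConn x y)) +
          p / (p + q * (1 - p)) * (μ n).real ((fun η => η \ {s(x, y)}) ⁻¹' (H₀ ∩ (openConn x y)ᶜ)))
    (huniq : ∀ᵐ ω ∂P, numInfiniteClusters ω ≤ 1)
    {H₀ : Set (BondConfig (Site d))} (hH₀ : MeasurableSet H₀) :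
    P.real ({ω | s(x, y) ∈ ω} ∩ (fun η => η \ {s(x, y)}) ⁻¹' H₀) =
      p * P.real ((fun η => η \ {s(x, y)}) ⁻¹' (H₀ ∩ openConn x y)) +
        p / (p + q * (1 - p)) * P.real ((fun η => η \ {s(x, y)}) ⁻¹' (H₀ ∩ (openConn x y)ᶜ)) := by
  have hden : 0 < p + q * (1 - p) := add_mul_one_sub_pos hp hq
  have hπ0 : 0 ≤ p / (p + q * (1 - p)) := div_nonneg hp.1 hden.le
  refine measureReal_setOf_mem_inter_preimage_eq_of_forall_isLocalEvent hp.1 hπ0 (fun A hA => ?_) hH₀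
  have hAm : MeasurableSet A := measurableSet_of_isLocalEvent_holds hA
  by_cases hpπ : p = p / (p + q * (1 - p))
  · -- degenerate case `p = π`: no uniqueness needed
    have t1 : Tendsto (fun n => (μ n).real ({ω | s(x, y) ∈ ω} ∩ (fun η => η \ {s(x, y)}) ⁻¹' A)) atTop
        (𝓝 (P.real ({ω | s(x, y) ∈ ω} ∩ (fun η => η \ {s(x, y)}) ⁻¹' A))) :=
      tendsto_measureReal_of_tendsto_measure_isLocalEvent hconv
        (isLocalEvent_inter_preimage (s(x, y)) (isLocalEvent_setOf_mem (s(x, y))) hA)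
    have t2 := tendsto_measureReal_of_tendsto_measure_isLocalEvent hconv (isLocalEvent_preimage_sdiff hA {s(x, y)})
    have hev : ∀ᶠ n in atTop, (μ n).real ({ω | s(x, y) ∈ ω} ∩ (fun η => η \ {s(x, y)}) ⁻¹' A) =
        p * (μ n).real ((fun η : BondConfig (Site d) => η \ {s(x, y)}) ⁻¹' A) := by
      filter_upwards [hE] with n hn
      rw [hn hAm, ← hpπ, ← mul_add, ← measureReal_preimage_sdiff_eq_add (μ n) hAm]
    have hlim : P.real ({ω | s(x, y) ∈ ω} ∩ (fun η => η \ {s(x, y)}) ⁻¹' A) =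
        p * P.real ((fun η : BondConfig (Site d) => η \ {s(x, y)}) ⁻¹' A) :=
      tendsto_nhds_unique (t1.congr' hev) (t2.const_mul p)
    rw [hlim, measureReal_preimage_sdiff_eq_add P hAm, mul_add, ← hpπ]
  · -- `p ≠ π` forces `p < 1`, and then `max(p, π) < 1`
    have hp1 : p < 1 := by
      rcases hp.2.lt_or_eq with h | h
      · exact h
      · exfalso
        apply hpπ
        rw [h]
        norm_num
    have hπ1 : p / (p + q * (1 - p)) < 1 := by
      rw [div_lt_one hden]
      nlinarith [mul_pos hq (sub_pos.2 hp1)]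
    have hc1 : max p (p / (p + q * (1 - p))) < 1 := max_lt hp1 hπ1
    have hc0 : 0 ≤ max p (p / (p + q * (1 - p))) := le_max_of_le_left hp.1
    have hle : ∀ ⦃H : Set (BondConfig (Site d))⦄, MeasurableSet H →
        P.real ({ω | s(x, y) ∈ ω} ∩ (fun η => η \ {s(x, y)}) ⁻¹' H) ≤
          max p (p / (p + q * (1 - p))) * P.real ((fun η => η \ {s(x, y)}) ⁻¹' H) := fun H hH =>
      measureReal_setOf_mem_inter_preimage_le_of_forall_isLocalEvent hc0
        (fun B hB => measureReal_setOf_mem_inter_preimage_le_of_localLimit_of_isLocalEvent hconv hE hB) hH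
    have h0 := measureReal_preimage_sdiff_not_numInfiniteClusters_le_one_eq_zero hc1 hle huniq
    exact measureReal_setOf_mem_inter_preimage_eq_of_localLimit_of_isLocalEvent hp hq hlat hconv hE
      (tendsto_measureReal_exit_inter_not_openConnVia P x y h0) hA

variable (d) in
/-- **Grimmett 2006, Theorem (4.31) — local limits with the 0/1-infinite-cluster property are DLR random-cluster
measures** (abstract form, general `d`, `0 ≤ p ≤ 1`, `q > 0`): let `μ_n` be finite measures on `Ω = {0,1}^{pairs of ℤ^d}`
carried by lattice configurations, converging to the probability measure `P` on every local event, such that for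
every lattice edge `e`, EVENTUALLY `μ_n` has the one-edge conditional probabilities (4.38) at `e` (e.g. finite-volume
random-cluster measures `φ^{ξ_n}_{Λ_n,p,q}` with `Λ_n ↑ ℤ^d`, or finite convex combinations of such). If `P` has
almost surely at most one infinite cluster, then `P ∈ R_{p,q}` (`IsDLRRandomCluster d p q P`, Def. (4.29)).
[cite: Grimmett2006, Thm. (4.31) pp. 81–86; Prop. (4.37)(b) eq. (4.38)] -/
theorem isDLRRandomCluster_of_localLimit [IsProbabilityMeasure P] [∀ n, IsFiniteMeasure (μ n)]
    (hp : p ∈ Set.Icc (0 : ℝ) 1) (hq : 0 < q)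
    (hlat : ∀ n, ∀ᵐ ω ∂(μ n), ω ⊆ (zdGraph d).edgeSet)
    (hconv : ∀ A : Set (BondConfig (Site d)), IsLocalEvent A → Tendsto (fun n => μ n A) atTop (𝓝 (P A)))
    (hE : ∀ ⦃x y : Site d⦄, (zdGraph d).Adj x y → ∀ᶠ n in atTop, ∀ ⦃H₀ : Set (BondConfig (Site d))⦄,
      MeasurableSet H₀ →
      (μ n).real ({ω | s(x, y) ∈ ω} ∩ (fun η => η \ {s(x, y)}) ⁻¹' H₀) =
        p * (μ n).real ((fun η => η \ {s(x, y)}) ⁻¹' (H₀ ∩ openConn x y)) +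
          p / (p + q * (1 - p)) * (μ n).real ((fun η => η \ {s(x, y)}) ⁻¹' (H₀ ∩ (openConn x y)ᶜ)))
    (huniq : ∀ᵐ ω ∂P, numInfiniteClusters ω ≤ 1) :
    IsDLRRandomCluster d p q P :=
  isDLRRandomCluster_of_oneEdge d hp hq fun _ _ hxy _ hH₀ =>
    measureReal_setOf_mem_inter_preimage_eq_of_localLimit hp hq hlat hconv (hE hxy) huniq hH₀

end Assembly


/-! ### Theorem (4.31) for the weak limits `W_{p,q}`: limits of finite-volume random-cluster measures -/

section LimitPoints

variable {p q : ℝ} {P : Measure (BondConfig (Site d))}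

variable (d) in
/-- **Grimmett 2006, Theorem (4.31), for the limit points of finite-volume random-cluster measures with arbitrary
lattice boundary conditions** (`W_{p,q}` proper; general `d`, `0 ≤ p ≤ 1`, `q > 0`): let `Λ_n` be finite regions
eventually containing every lattice edge and `ξ_n ⊆ 𝔼^d` boundary conditions; if the finite-volume random-cluster
measures `φ^{ξ_n}_{Λ_n,p,q}` (`rcCondLaw p q (Λ n) (ξ n)`) converge to the probability measure `P` on every local
event and `P` has almost surely at most one infinite cluster, then `P ∈ R_{p,q}`.
[cite: Grimmett2006, Def. (4.26) (W_{p,q}), Thm. (4.31) pp. 81–86] -/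
theorem isDLRRandomCluster_of_tendsto_rcCondLaw [IsProbabilityMeasure P] (hp : p ∈ Set.Icc (0 : ℝ) 1) (hq : 0 < q)
    {Λ : ℕ → Finset (Site d)} {ξ : ℕ → BondConfig (Site d)} (hξ : ∀ n, ξ n ⊆ (zdGraph d).edgeSet)
    (hΛ : ∀ ⦃x y : Site d⦄, (zdGraph d).Adj x y → ∀ᶠ n in atTop, s(x, y) ∈ edgesIn (zdGraph d) (Λ n))
    (hconv : ∀ A : Set (BondConfig (Site d)), IsLocalEvent A →
      Tendsto (fun n => rcCondLaw p q (Λ n) (ξ n) A) atTop (𝓝 (P A)))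
    (huniq : ∀ᵐ ω ∂P, numInfiniteClusters ω ≤ 1) :
    IsDLRRandomCluster d p q P := by
  haveI : ∀ n, IsFiniteMeasure (rcCondLaw p q (Λ n) (ξ n)) := fun n => by
    haveI := isProbabilityMeasure_rcCondLaw hp hq (Λ n) (ξ n)
    infer_instance
  exact isDLRRandomCluster_of_localLimit d (μ := fun n => rcCondLaw p q (Λ n) (ξ n)) hp hq
    (fun n => rcCondLaw_ae_subset_edgeSet hp hq (Λ n) (hξ n)) hconv
    (fun x y hxy => (hΛ hxy).mono fun n hn H₀ hH₀ =>
      rcCondLaw_real_edgeOpen_inter_preimage_eq hp hq (Λ n) (ξ n) hn hH₀)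
    huniq

variable (d) in
/-- **Non-percolating limit points are DLR random-cluster measures** (Thm. (4.31) in the regime without infinite
clusters — e.g. every subsequential local limit of finite-volume measures in a non-percolating regime; no FKG input,
any `q > 0`): with `Λ_n`, `ξ_n` as above, if `P(x ↔ ∞) = 0` for every site `x`, then `P ∈ R_{p,q}`.
[cite: Grimmett2006, Thm. (4.31) pp. 81–86] -/
theorem isDLRRandomCluster_of_tendsto_rcCondLaw_of_forall_percolatesAt_eq_zero [IsProbabilityMeasure P]
    (hp : p ∈ Set.Icc (0 : ℝ) 1) (hq : 0 < q)
    {Λ : ℕ → Finset (Site d)} {ξ : ℕ → BondConfig (Site d)} (hξ : ∀ n, ξ n ⊆ (zdGraph d).edgeSet)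
    (hΛ : ∀ ⦃x y : Site d⦄, (zdGraph d).Adj x y → ∀ᶠ n in atTop, s(x, y) ∈ edgesIn (zdGraph d) (Λ n))
    (hconv : ∀ A : Set (BondConfig (Site d)), IsLocalEvent A →
      Tendsto (fun n => rcCondLaw p q (Λ n) (ξ n) A) atTop (𝓝 (P A)))
    (hperc : ∀ x : Site d, P (percolatesAt x) = 0) :
    IsDLRRandomCluster d p q P := by
  refine isDLRRandomCluster_of_tendsto_rcCondLaw d hp hq hξ hΛ hconv ?_
  have h : ∀ᵐ ω ∂P, ∀ x : Site d, ω ∉ percolatesAt x := by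
    rw [ae_all_iff]
    intro x
    rw [ae_iff]
    simpa only [not_not, Set.setOf_mem_eq] using hperc x
  filter_upwards [h] with ω hω
  have h0 : numInfiniteClusters ω = 0 := by
    by_contra hne
    obtain ⟨x, hx⟩ := (numInfiniteClusters_ne_zero_iff ω).1 hne
    exact hω x hx
  rw [h0]
  exact zero_le_one

end LimitPoints

end Summit.CriticalPhenomena.PercolationContinuityZ3.Theorems.FK

end
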